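import Summits.BirchSwinnertonDyer.Rank1Residual.F1Sign2.DefiniteMod2WaldspurgerAtTwo
import HarnessLib.Audit.Tags
import HarnessLib

/-!
# AN-43 / §30 «THE τ-REFLECTION LAW, THE Φ-FREE ZERO SET, THE FIXED-POINT POSITION LAW at `N ≡ 1 (mod 4)`, the `Δ > 0` vanishing» (-an g27; typer -ty g20)

SPLIT FILE (gate lint: statement files ≤ 1000 lines — the v6 append to `DefiniteMod2WaldspurgerAtTwo.lean` p748316 BOUNCED at 1190 lines): this module IMPORTS
`DefiniteMod2WaldspurgerAtTwo.lean` (v5 p747161: the AN-43 frame `OddToricPeriod`, (TR) `ToricTorsorRelation`, (D0) `ModTwoToricCosetStructure`, …) and carries ONLY the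
§30 rows of -an g27's crux workfile v9 (`Cruxes/RankOneAtTwoBigImageOddLocal/DefiniteMod2WaldspurgerAN43.lean` 714a99dc922491a4, `section V9`, l.658–899), in the same
namespace `Summit.BirchSwinnertonDyer.Rank1Residual.F1Sign2.ANg25`, bodies VERBATIM (re-namespaced), riders appended; kernel sibling `DefiniteMod2WaldspurgerReflectionAtTwoKernel.lean`.

CONTENT (typer -ty g20): -an g27 §30 rows (crux workfile v9 714a99dc922491a4): (R) GrossPointReflectionLaw, (Tτ) TauTransporterExists, (D0♯) ModTwoToricReflectionCosetLaw, (F) ToricParityEqFixedPointCount, (P) FixedPointTransporterOddDisc, (V) ModTwoFixedPointValueOneModFour, (β) ModTwoToricVanishingOfPosDisc, (β′) ToricPeriodEvenOfPosDisc, (E4) NoAnticommutingPairFourExactlyDvd, (P₈) FixedPointTransporterEightDvd — VERBATIM, riders appended; TAGS per REF1 R261e (the port gate's typing advice, over -an's uniform «theorem-candidate» labels): (R), (Tτ), (E4) PLAIN (BSD-free theorem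
targets: (R)/(E4) paper theorems re-derived by REF1, (Tτ) print), the seven laws (D0♯), (F), (P), (P₈), (V), (β), (β′) `@[conjecture]` with the T47 shas in their docstrings;
glue `modTwoFixedPointValue_of_parts` ((D0♯) ∧ (P) ⟹ (V)) to the kernel; the workfile's note `posDisc_disjoint_from_AN43_note : True` folded as text.  PORT GATE = REF1-AUDIT
§261 (-ref1 g22, 2026-08-29T22:15:00Z; Probe261.lean rc 0; fold261 re-fold of the raw T47 rows — FULL kit j335967 output 8a45d5b08bdeec84, v2 j336039 9d5c2d3b6ff6213e, OOS
9b6657fd610a6a23): **all 11 Props SURVIVE as typed; glue kernel-sound; 0 KILLED; PARTITION none; beyond-print theorem: no**; riders R261a–e (none blocking; R261d: this file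
must build with 0 warnings under `Rank1Residual/F1Sign2/` — confirmed by the typer's farm check / dry-run).  REF2 PLACEMENT (-ref2 g58, 2026-08-29T22:15:22Z): (R) = PRINT
([cite: BertoliniDarmon1996, Prop. 2.6] + proof of Prop. 2.13; Gross 1987 §3) — routine; (Tτ) Eichler / [cite: VignerasLNM800, Ch. III §5] — print; (D0♯) ⟸ (D0)+(R) routine; (F)
routine / new formulation; (P)/(P₈) small BEYOND-PRINT theorem-candidates (ancestry [cite: GrossZagier1985SingularModuli, §3] linking ideals); (V) fine; (E4) elementary,
provable now ([cite: Serre1973, Ch. III Thm. 1]); (β)/(β′) NEW small theorem-candidates beyond print ((TR) + [cite: KedlayaMedvedovsky2019, Thm. 2] + Chebotarev).  OVERALL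
(REF2): with (R), (Tτ), (D0), (P), (P₈), (E4), (F) the parity law (H) at `N ≡ 1 (mod 4)` is REDUCED TO BSD-FREE PIECES each routine or small — if they are landed as theorems,
(H)|_{N ≡ 1 (4)} (toric side) becomes the cell's first BEYOND-PRINT THEOREM (its odd-`d` L-shadow is Zhai 2016 = print; the L-side transfer stays modulo (R1)); grade of the
mechanism unchanged (new-mechanism-candidate, critic's call).  Beyond-print theorem LANDED: none; BSD not proved.
BSD is not proved by anything here; 23715 is not closed by anything here.
-/

namespace Summit.BirchSwinnertonDyer.Rank1Residual.F1Sign2.ANg25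

open Literature.NumberTheory.Automorphic Literature.NumberTheory.Automorphic.Brandt
open Literature.NumberTheory.EllipticCurves
open scoped NumberField nonZeroDivisors

/-! ## v9 (-an g27, MEMO-an §30): the τ-REFLECTION LAW (base-point free, every prime `N`), the Φ-FREE zero set, the
FIXED-POINT POSITION LAW at `N ≡ 1 (mod 4)` (closes g26 OPEN #1), the `Δ > 0` vanishing, and one kernel-checked derivation.

Engine: kit job T47 (`jobT47/t47.py`, Sage 10.x; smoke j335956; FULL j335967 = every prime-conductor `S₃` class `N ≤ 1000`, both signs of
`Δ`: 62 classes, 98 torsors, 1465 `(W, d)` rows, output sha16 8a45d5b08bdeec84, 0 errors): per k-torsor it computes the permutation group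
`G = ⟨P_𝔮⟩ ≅ Pic(O)` (regular), the reflection `τ (I, η) = (I, -η)`, the TRANSPORTER `δ(x) ∈ Pic(O)` with `τ x = δ(x) ⋆ x`, and a
Φ-FREE cubic character `χ_W : G → ℤ/3` read off FROBENIUS in `ℚ(W[2]) ⊃ k` (`χ_W(𝔮_ℓ) = 0 ⟺ 2 ∣ a_ℓ`, else `σ^{±1}`); on the
K-side it lists the `ρ`-fixed Gross points of `𝓞_K` through their anticommuting `η` and locates `x(y)` on the k-torsor.
ERRATUM E-an-30a (to memo29b §29.10 (G4)): for `N ≡ 7 (mod 8)` and `8 ∣ d` the `ρ`-fixed points are ALL of type F (`𝓞_k`-points;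
t43eta2 j334921, N = 503: 29/29), not of type S; for `N ≡ 3 (mod 8)` and `8 ∣ d` there are none.  `AxisRecursionAtTwo` is unaffected. -/

section V9
open scoped Pointwise

/-- **(R) REFLECTION LEMMA (support; theorem-candidate, pure algebra of Gross points; -an g27 §30.1).**  Let `k` be imaginary
quadratic with conjugation `c`, `(ψ, I)` a Gross point of `𝓞_k` on `S.O`, and suppose the CONJUGATE point `(ψ ∘ c, I)` lies in the
`Pic(𝓞_k)`-orbit of `(ψ, I)`: there are an integral ideal `𝔡` and `α ∈ Dˣ` with `α · ψ(𝔡) I = I` and `α ψ(z) α⁻¹ = ψ(c z)` (the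
TRANSPORTER `δ(x) = [𝔡]`; it exists whenever the Gross points of `𝓞_k` form one orbit, e.g. `N` prime ramified in `k`:
`TauTransporterExists`).  THEN the orbit map is REFLECTION-SYMMETRIC: `[𝔞⁻¹ 𝔡] ⋆ x` and `[𝔞] ⋆ x` have the same right-ideal
class, `hx.act (𝔞⁻¹ * [𝔡]) = hx.act 𝔞` — because `𝔞 ⋆ (ψ∘c, I) = (ψ∘c, ψ(𝔞̄) I)`, `ψ(𝔞̄) I = ψ(𝔞̄) α ψ(𝔡) I = α ψ(𝔞 𝔡) I` and
`[𝔞̄] = [𝔞]⁻¹`.  Equivalently `τ(𝔞 ⋆ x) = 𝔞⁻¹ ⋆ τ(x)`: `τ` acts on the torsor as a REFLECTION, `δ(𝔞 ⋆ x) = 𝔞⁻² δ(x)`.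
TREE: `Brandt.IsGrossPoint.comp_algEquiv` (`(ψ ∘ c, I)` is a Gross point) and `Brandt.IsGrossPoint.act_comp_algEquiv`
(`[J]·[(ψ∘c, I)] = [c̃ J]·[(ψ, I)]`, -ty `BrandtGrossPointReflection.lean`) supply the twist; what is left is `[c̃ J] = [J]⁻¹` for
imaginary quadratic `k` and the transporter bookkeeping.  T47: the permutation `T` satisfies `T P_𝔮 T = P_𝔮⁻¹` on every torsor
(ANTI = True 98/98, j335967).
(RIDER, typer -ty g20: PLAIN theorem-target (R) per REF1 R261e — BSD-free, «provable».  REF1-AUDIT §261: **SURVIVES; a PAPER THEOREM** (re-derived: pure `IsGrossPoint.act` algebra, any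
order; what is left in-tree is `[c̃ J] = [J]⁻¹` for imaginary quadratic `k`); T47 FULL (kit j335967, output sha16 8a45d5b08bdeec84): `T P_𝔮 T = P_𝔮⁻¹` on 98/98 torsors.  REF2 (22:15Z):
= PRINT — [cite: BertoliniDarmon1996, Prop. 2.6] (action of `τ` on the Gross points) and the proof of Prop. 2.13 («`τστ = σ⁻¹` for all `σ ∈ G_n`» ⟹ the functional equation
`θ^τ = w·θ*`, definite case (11)); [cite: Gross1987Heights, §3] (dihedral action on the `x_𝔞`) — corollary-of-print / routine.) -/
def GrossPointReflectionLaw : Prop :=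
  ∀ (N : ℕ) (k : Type) [Field k] [NumberField k], IsImaginaryQuadratic k →
  ∀ (S : Brandt.XiSetup 1 N) (ψ : k →ₐ[ℚ] S.D) (I : Submodule ℤ S.D) (hx : Brandt.IsGrossPoint S.O ψ I)
    (c : k ≃ₐ[ℚ] k) (𝔡 : (Ideal (𝓞 k))⁰) (α : (S.D)ˣ),
    c ≠ AlgEquiv.refl → α • Brandt.grossTranslate ψ 𝔡 I = I → (∀ z : k, (α : S.D) * ψ z = ψ (c z) * α) →
    ∀ 𝔞 : ClassGroup (𝓞 k), hx.act (𝔞⁻¹ * ClassGroup.mk0 𝔡) = hx.act 𝔞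

/-- **(Tτ) THE TRANSPORTER EXISTS (support; theorem-candidate; -an g27 §30.1).**  For a PRIME `N` and `k = ℚ(√-N)` (discriminant
`-N` or `-4N`; `N` ramifies in `k` and in `S.D`) the Gross points of `𝓞_k` on a definite set-up of discriminant `N` form ONE
`Pic(𝓞_k)`-orbit of size `h(𝓞_k)` (Eichler's optimal-embedding count with the Atkin–Lehner orbit folded in; T44/T45/T47: MASS_OK and
`transitive = True` on all 130 + 19 torsors), so the conjugate point `(ψ ∘ c, I)` IS a translate `[𝔡] ⋆ (ψ, I)`.
(RIDER, typer -ty g20: PLAIN theorem-target (Tτ) per REF1 R261e — print.  REF1-AUDIT §261: **SURVIVES; PRINT** — optimal embeddings of `𝓞_k` into the maximal orders of the definite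
algebra of discriminant `N` number `h(𝓞_k)·∏_{p ∣ N}(1 − (disc k / p)) = h(𝓞_k)` (`N` ramified), `Pic(𝓞_k)` acts freely ⟹ simply transitively ([cite: Gross1987Heights, §3]; Eichler;
Voight §30), and `(ψ ∘ c, I)` is again such a point ⟹ it is `[𝔡] ⋆ (ψ, I)` up to `Dˣ`.  REF2 (22:15Z): Eichler's optimal-embedding count ([cite: VignerasLNM800, Ch. III §5]; Gross
1987 §3) — routine, print.) -/
def TauTransporterExists : Prop :=
  ∀ (N : ℕ), N.Prime →
  ∀ (k : Type) [Field k] [NumberField k], IsImaginaryQuadratic k →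
    (NumberField.discr k = -(N : ℤ) ∨ NumberField.discr k = -(4 * N : ℤ)) →
  ∀ (S : Brandt.XiSetup 1 N) (ψ : k →ₐ[ℚ] S.D) (I : Submodule ℤ S.D), Brandt.IsGrossPoint S.O ψ I →
  ∀ (c : k ≃ₐ[ℚ] k), c ≠ AlgEquiv.refl →
    ∃ (𝔡 : (Ideal (𝓞 k))⁰) (α : (S.D)ˣ),
      α • Brandt.grossTranslate ψ 𝔡 I = I ∧ ∀ z : k, (α : S.D) * ψ z = ψ (c z) * α

/-- **(D0♯) THE Φ-FREE ZERO SET — REFLECTION COSET LAW (theorem-candidate ⟸ (D0) `ModTwoToricCosetStructure` + (R); BSD-free;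
-an g27 §30.2; base-point free, EVERY prime `N`, both `N mod 4` classes).**  In the setting of (D0) (`N` prime, `ρ̄_{W,2}` onto `S₃`,
`-N·Δ_W` a square, `k = ℚ(√-N)`, `Φ = w·φ` on a Gross point `x = (ψ, I)` of `𝓞_k`) let `[𝔡] = δ(x)` be the transporter of `x`
(`τ x = [𝔡] ⋆ x`, data `(c, 𝔡, α)` as in (R)).  THEN either `Φ̄ ≡ 0` on the orbit, or there is a subgroup `H` of index 3 with the
FROBENIUS property (`[𝔮_ℓ] ∈ H ⟺ 2 ∣ a_ℓ(W)` for degree-one primes `𝔮_ℓ ∤ 2N`, i.e. `H = ker χ_W`) such that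
**`Φ(𝔞 ⋆ x)` is even ⟺ `𝔞² δ(x)⁻¹ ∈ H`** — the zero set is the UNIQUE `τ`-stable `H`-coset (proof from (D0): `Z = 𝔟H` is `τ`-stable,
`τ(𝔞⋆x) = 𝔞⁻¹δ⋆x`, so `δ ∈ 𝔟²H`, and squaring is a bijection on `G/H ≅ ℤ/3`).  No base point `x_τ`, no parity of `h`: for
`N ≡ 1 (mod 4)` (`h(-4N)` even, NO `τ`-fixed point: 24/24 in T45) this is the coset identification left open in g26 (OPEN #1).
T47 (Φ-free `χ_W` from Frobenius in `ℚ(W[2])`), FULL run j335967 (`N ≤ 1000`): ALL 20 COSET torsors (15 classes with `r_an = 0` and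
`L(W,1)/Ω` odd; `h = 3 … 33`, among them 109a1 with `N ≡ 5 (mod 8)`, `h = 6`) have `Stab(Z) = ker χ_W` AND `Z = {x : χ_W(δ(x)) = 0}`
(20/20), and `{x : χ_W(δ(x)) = 0}` is a single `τ`-stable coset on EVERY torsor through which `χ_W` factors (51/51, incl. 31 with
`Φ̄ ≡ 0`); OUT OF SAMPLE (kit j336023: `N ≡ 1 (mod 4)`, `1000 < N ≤ 3000`, rank 0, out sha16 9d5c2d3b6ff6213e) six more COSET
torsors (1297a1, 1321a1, 1373a1, 1901a1, 2237a1, 2393a1; `h = 12 … 60`): 6/6 on all three counts.  `χ_W` factors through `Pic(ℤ[√-N])` always (40/40) and through `Pic(𝓞_k)` iff `W` is ORDINARY at 2 (11/11 ordinary,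
0/19 supersingular: 5–29 Frobenius conflicts each) — the (D0-ss) mechanism, measured.
(RIDER, typer -ty g20: `@[conjecture]` per REF1 R261e (the cell's own law with census support; -an labels it a theorem-candidate ⟸ (D0) + (R)).  REF1-AUDIT §261:
**SURVIVES** — paper derivation from (D0)+(R) checked (τ-stable coset bookkeeping); T47 re-fold (FULL j335967 8a45d5b08bdeec84 / v2 j336039 9d5c2d3b6ff6213e / OOS 9b6657fd610a6a23): at
fixed points on COSET-verdict torsors `inZ ⟺ χ = 0` 272/272 FULL, 221/221 OOS; row flag `inZeqChi0` 1465/1465 + 461/461 (R261c: the OOS «401 fixed points» = 404 raw − the 3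
even-`d` points of 2143a1, `N ≡ 7 (8)`).  REF2 (22:15Z): ⟸ (D0)+(R) routine; the base-point-free form is the right statement for `N ≡ 1 (4)` — concur.) -/
@[conjecture] def ModTwoToricReflectionCosetLaw : Prop :=
  ∀ (W : WeierstrassCurve ℚ) [W.IsElliptic] [W.IsGloballyMinimal] (N : ℕ),
    N.Prime → W.conductorNorm ℤ = N → W.HasSurjectiveModNGaloisRep 2 → IsSquare (-(N : ℚ) * W.Δ) →
  ∀ (k : Type) [Field k] [NumberField k], IsImaginaryQuadratic k →
    (NumberField.discr k = -(N : ℤ) ∨ NumberField.discr k = -(4 * N : ℤ)) →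
  ∀ (S : Brandt.XiSetup 1 N) [Fintype (Brandt.ClassSet S.O)] (φ : Brandt.ClassSet S.O → ℤ) (ψ : k →ₐ[ℚ] S.D)
    (I : Submodule ℤ S.D) (hx : Brandt.IsGrossPoint S.O ψ I),
    φ ≠ 0 → Brandt.eigenLattice N (Brandt.matrix S.O) (fun p => W.frobeniusTrace p) = ℤ ∙ φ →
  ∀ (c : k ≃ₐ[ℚ] k) (𝔡 : (Ideal (𝓞 k))⁰) (α : (S.D)ˣ),
    c ≠ AlgEquiv.refl → α • Brandt.grossTranslate ψ 𝔡 I = I → (∀ z : k, (α : S.D) * ψ z = ψ (c z) * α) →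
    (∀ 𝔞 : ClassGroup (𝓞 k), Even ((Brandt.weight S.O (hx.act 𝔞) : ℤ) * φ (hx.act 𝔞))) ∨
    (∃ H : Subgroup (ClassGroup (𝓞 k)), H.index = 3 ∧
        (∀ (ℓ : ℕ) (𝔮 : (Ideal (𝓞 k))⁰), ℓ.Prime → ℓ ≠ 2 → ℓ ≠ N →
            Ideal.absNorm (𝔮 : Ideal (𝓞 k)) = ℓ → (ClassGroup.mk0 𝔮 ∈ H ↔ Even (W.frobeniusTrace ℓ))) ∧
        (∀ 𝔞 : ClassGroup (𝓞 k),
            Even ((Brandt.weight S.O (hx.act 𝔞) : ℤ) * φ (hx.act 𝔞)) ↔ 𝔞 * 𝔞 * (ClassGroup.mk0 𝔡)⁻¹ ∈ H))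

/-- **(F) FIXED-POINT REDUCTION, `ρ`-FREE FORM (theorem-candidate; §28.3f made typable; -an g27 §30.3).**  For a PRIME `N`, `W` of
conductor `N` with definite eigen-line `ℤφ`, `K = ℚ(√d)` with `N` inert and a Gross point `y = (ψ_K, I)` of `𝓞_K`: the Frobenius
reflection `ρ = τ_K ∘ w_N` of the orbit (`(ψ_K, J) ↦ (ψ_K ∘ c_K, J·𝔐)`, `𝔐` the two-sided prime over `N`) preserves `Φ̄ = w·φ mod 2`
(`w_N φ = ±φ`), so `m_d = Σ_𝔞 Φ(𝔞 ⋆ y) ≡ Σ_{Fix ρ} Φ̄ (mod 2)`; and a point `(ψ_K, J)` is `ρ`-FIXED iff its left order contains an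
`η` with `η² = -N` ANTICOMMUTING with `ψ_K(√d)` (then `J𝔐 = ηJ` and `Ad(η⁻¹) ∘ ψ_K ∘ c_K = ψ_K`; conversely the transporter of a
fixed point is such an `η` up to a unit — T43η2: `η = e·ᾱ`, sign always `-1` since `N` is not a norm from `K`).  Hence, with NO
mention of `𝔐`: **`m_d(W)` is odd iff an odd number of classes `𝔞` have `Φ(𝔞 ⋆ y)` odd AND an anticommuting `η` of square `-N`
in `O_L(ψ_K(𝔞) I)`.**  Census: T43 FXSUM (26 classes) and T47 j335967: `|Fix ρ_d| = 2^{ω(d)-1}·[no odd p ∣ d inert in k]` and `M_w ≡ Σ_{Fix} Φ (mod 2)` on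
1465/1465 `(W, d)` rows (62 classes, `Δ` of both signs).
(RIDER, typer -ty g20: `@[conjecture]` per REF1 R261e.  REF1-AUDIT §261: **SURVIVES** — T47: `M_w ≡ Σ_{Fix} Φ (mod 2)` 1465/1465 FULL, 461/461 OOS; `|Fix|` = the engine's
prediction 1465/1465 AND = REF1's OWN closed form (`N ≡ 1 (4)`: odd `d ↦ 2^{ω(d)−1}·[no odd p ∣ d inert in k]`, `4 ∥ d ↦ 0`, `8 ∣ d ↦ 2^{ω(m)}·[no odd p ∣ m inert]`) on all
814 `N ≡ 1 (4)` rows FULL + 447 OOS (T47 shas 8a45d5b08bdeec84 / 9d5c2d3b6ff6213e / 9b6657fd610a6a23).  REF2 (22:15Z): involution counting + a [cite: BertoliniDarmon1996, Prop. 2.6]-type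
description of `ρ = τ_K ∘ w_N` — routine / new formulation, BSD-free.) -/
@[conjecture] def ToricParityEqFixedPointCount : Prop :=
  ∀ (W : WeierstrassCurve ℚ) [W.IsElliptic] [W.IsGloballyMinimal] (N : ℕ), N.Prime → W.conductorNorm ℤ = N →
  ∀ (K : Type) [Field K] [NumberField K] (d : ℤ), IsImaginaryQuadratic K → NumberField.discr K = d →
    jacobiSym d N = -1 →
  ∀ (S : Brandt.XiSetup 1 N) [Fintype (Brandt.ClassSet S.O)] (φ : Brandt.ClassSet S.O → ℤ) (ψK : K →ₐ[ℚ] S.D)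
    (I : Submodule ℤ S.D) (hy : Brandt.IsGrossPoint S.O ψK I) (cK : K ≃ₐ[ℚ] K),
    φ ≠ 0 → Brandt.eigenLattice N (Brandt.matrix S.O) (fun p => W.frobeniusTrace p) = ℤ ∙ φ → cK ≠ AlgEquiv.refl →
    (Odd (Brandt.toricPeriod S.O ψK I (fun x => (Brandt.weight S.O x : ℤ) * φ x)) ↔
      Odd (Nat.card {𝔞 : ClassGroup (𝓞 K) //
        Odd ((Brandt.weight S.O (hy.act 𝔞) : ℤ) * φ (hy.act 𝔞)) ∧
        ∃ η ∈ Brandt.leftOrder (Brandt.grossTranslate ψK (Brandt.idealRep 𝔞) I),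
          η * η = -(N : S.D) ∧ ∀ w : K, η * ψK w = ψK (cK w) * η}))

/-- **(P) FIXED-POINT POSITION LAW at `N ≡ 1 (mod 4)`, odd `d` (theorem-candidate, PURE QUATERNION ARITHMETIC — no curve, no
L-value; -an g27 §30.3; the K-side ↔ k-side bridge that closes g26 OPEN #1).**  `N ≡ 1 (mod 4)` prime, `k = ℚ(√-N)` (`𝓞_k = ℤ[√-N]`,
discriminant `-4N`), `K = ℚ(√d)`, `d` odd fundamental, `(d/N) = -1`.  Let `I` carry BOTH a Gross point `x = (ψ, I)` of `𝓞_k` and a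
Gross point `y = (ψ_K, I)` of `𝓞_K` with `ψ(√-N)` anticommuting with `ψ_K(√d)` (= `y ∈ Fix ρ_d` and `x = x(y)`, see (F)).  THEN the
transporter of `x` is the class of an ideal of norm `|d|`: **`τ x = [𝔡] ⋆ x` with `𝔡 = ∏_{p ∣ d} 𝔮_p^{(e_p)}`, one prime of `k` over
each (necessarily split) `p ∣ d`** — locally: `τx = (bI, η)` with `b = ψ_K(√d)`, and `bI = β·I` for an idele `β` of `k` with `β_p = 1`
at `p ∤ d` (at `p = 2` too: `nrd b = -d` is a 2-unit) and `β_p` a uniformiser of exactly one of `𝔮_p, 𝔮̄_p` at `p ∣ d` (in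
`η`-diagonal coordinates `b = [[0,β],[γ,0]]`, `βγ = d`).  The sign vector `e(y) ∈ {±1}^{ω(d)}/±` runs over all classes exactly once as
`y` runs over `Fix ρ_d` (|Fix| = 2^{ω(d)-1}), and `x(𝔭_p ⋆ y) = 𝔮_p^{±1} ⋆ x(y)`.  T47 j335967, cells `N1mod4|·|d odd` (10 classes
`N ≡ 1 mod 4`, `Δ < 0`; 12 more with `Δ > 0`): `δ(x(y)) = ∏P_p^{e_p}` EXACTLY at all 543 fixed points (213 + 330), every ramified
step `x(𝔭_p ⋆ y) = P_p^{±1} τ^{0,1} x(y)` (0 failures), `χ_W`-multiset of the fixed points = Jacobsthal prediction on every row where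
`χ_W` is defined (169/169) — and out of sample (j336023, `1000 < N ≤ 3000`) at 319 more odd-`d` fixed points with 0 failures; even `d`: `δ ∈ ∏P_p^{e_p}·⟨[𝔮₂]⟩` with `[𝔮₂]` the ramified prime over 2 (order 2, `χ_W`-trivial) at all
131 fixed points.  The same numbers hold verbatim on the `ℤ[√-N]`- and `𝓞_k`-torsors for `N ≡ 3 (mod 4)` (686 fixed points, the
2-part in `C₃ = ker(Pic ℤ[√-N] → Pic 𝓞_k)` resp. `⟨[𝔮₂]⟩`; 0 failures) — that version is a statement on Gross points of conductor 2
(not yet in the tree, D-an-29c).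
(RIDER, typer -ty g20: `@[conjecture]` per REF1 R261e.  REF1-AUDIT §261: **SURVIVES** — odd `d`, `N ≡ 1 (4)`: 555 rows (208 `Δ < 0` / 347 `Δ > 0`), 423 with fixed points,
543 fixed points = 213 + 330; rec-level `grp = True` (`δ = ∏ P_p^{e_p}`) 543/543, `GRP_ALL ∧ STEPS_OK` 423/423, Jacobsthal multiset `MS_OK` 169/169 where `χ_W` is defined; the
132 rows without fixed points all have an inert odd `p ∣ d`; OOS 319 fixed points (316 in `N ≡ 1 (4)` cells + the 3 odd-`d` points of 2143a1 — R261c convention), 0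
failures; mutations: `Odd d` and `discr k = −4N` load-bearing (T47 shas 8a45d5b08bdeec84 / 9b6657fd610a6a23).  REF2 (22:15Z): local idelic quaternion arithmetic — **small
BEYOND-PRINT theorem-candidate**; ancestry: the «linking ideals» of pairs of optimal embeddings / singular moduli ([cite: GrossZagier1985SingularModuli, §3]; [cite: Gross1987Heights, §3])
— `δ(x(y))` of norm `|d|` is the Gross–Zagier linking ideal in the definite algebra; the mod-2 use is new.) -/
@[conjecture] def FixedPointTransporterOddDisc : Prop :=
  ∀ (N : ℕ), N.Prime → N % 4 = 1 →
  ∀ (k : Type) [Field k] [NumberField k], IsImaginaryQuadratic k → NumberField.discr k = -(4 * N : ℤ) →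
  ∀ (K : Type) [Field K] [NumberField K] (d : ℤ), IsImaginaryQuadratic K → NumberField.discr K = d → Odd d →
    jacobiSym d N = -1 →
  ∀ (S : Brandt.XiSetup 1 N) (ψ : k →ₐ[ℚ] S.D) (ψK : K →ₐ[ℚ] S.D) (I : Submodule ℤ S.D),
    Brandt.IsGrossPoint S.O ψ I → Brandt.IsGrossPoint S.O ψK I →
  ∀ (c : k ≃ₐ[ℚ] k) (cK : K ≃ₐ[ℚ] K) (θ : k), c ≠ AlgEquiv.refl → cK ≠ AlgEquiv.refl → θ * θ = -(N : k) →
    (∀ w : K, ψ θ * ψK w = ψK (cK w) * ψ θ) →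
    ∃ (𝔡 : (Ideal (𝓞 k))⁰) (α : (S.D)ˣ),
      α • Brandt.grossTranslate ψ 𝔡 I = I ∧ (∀ z : k, (α : S.D) * ψ z = ψ (c z) * α) ∧
      Ideal.absNorm (𝔡 : Ideal (𝓞 k)) = d.natAbs

/-- **(V) THE VALUE LAW AT A FIXED POINT, `N ≡ 1 (mod 4)`, odd `d` (theorem-candidate = (D0♯) + (P), kernel-checked below as
`modTwoFixedPointValue_of_parts`; -an g27 §30.3).**  In the setting of (P) with `W` as in (D0) (`N ≡ 1 (mod 4)`, so `W` is ordinary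
at 2 and `χ_W` is an everywhere-unramified character of `Pic ℤ[√-N]`): EITHER `Φ̄ ≡ 0` on the k-torsor, OR (`H = ker χ_W` of index 3
with the Frobenius property and) **`Φ(x(y))` is even ⟺ `[∏_{p∣d} 𝔮_p^{(e_p)}] ∈ H`**, i.e. `Φ̄(x(y)) = [Σ_p e_p(y)·χ_W(𝔮_p) ≢ 0 (mod 3)]`.
Summed over `Fix ρ_d` with (F) and Jacobsthal's count (§29.11) this is the odd-`d` half of the parity law (H) at `N ≡ 1 (mod 4)`:
`m_d` odd ⟺ `Φ̄ ≢ 0` ∧ every `p ∣ d` has `a_p(W)` odd.  T47 j335967: `Φ(x(y))` even ⟺ `χ_W(δ(x(y))) = 0` at every fixed point of every COSET torsor (1465/1465 rows, 0 exceptions);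
for `|d| = p` prime and `N ≡ 1 (mod 4)`: `Φ(x(y))` odd ⟺ `a_p(W)` odd on the 16 COSET rows (10 odd / 6 even), `Φ ≡ 0` on the 109 others;
OUT OF SAMPLE (j336023, the six COSET torsors with `1000 < N ≤ 3000`, `h = 12 … 60`): `Φ(x)` even ⟺ `χ_W(δ(x)) = 0` at all 401 fixed
points (461/461 rows), `|d| = p` prime: `Φ(x(y))` odd ⟺ `a_p(W)` odd on 90/90 COSET rows (61 odd / 29 even).
(RIDER, typer -ty g20: `@[conjecture]` per REF1 R261e (= (D0♯) + (P); the derivation is the kernel glue `modTwoFixedPointValue_of_parts`, REF1 A1: axioms = propext /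
Classical.choice / Quot.sound; it consumes every hypothesis of (V) with (D0♯) at the (P)-transporter, `𝔞 = 1`, and `hx.act 1` = the fixed point `x(y)` itself).  REF1-AUDIT §261:
**SURVIVES** — `|d| = p` prime, `N ≡ 1 (4)`: COSET rows `Fix2 = 1 : 0 = 10 : 6` (16 rows), non-COSET rows with a fixed point and `Δ < 0`: 109, all `Fix2 = 0` (+186 with `Δ > 0`,
all 0); OOS 61 : 29 on 90 COSET rows (T47 shas 8a45d5b08bdeec84 / 9b6657fd610a6a23).  REF2 (22:15Z): kernel-checked composition — fine.) -/
@[conjecture] def ModTwoFixedPointValueOneModFour : Prop :=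
  ∀ (W : WeierstrassCurve ℚ) [W.IsElliptic] [W.IsGloballyMinimal] (N : ℕ),
    N.Prime → N % 4 = 1 → W.conductorNorm ℤ = N → W.HasSurjectiveModNGaloisRep 2 → IsSquare (-(N : ℚ) * W.Δ) →
  ∀ (k : Type) [Field k] [NumberField k], IsImaginaryQuadratic k → NumberField.discr k = -(4 * N : ℤ) →
  ∀ (K : Type) [Field K] [NumberField K] (d : ℤ), IsImaginaryQuadratic K → NumberField.discr K = d → Odd d →
    jacobiSym d N = -1 →
  ∀ (S : Brandt.XiSetup 1 N) [Fintype (Brandt.ClassSet S.O)] (φ : Brandt.ClassSet S.O → ℤ) (ψ : k →ₐ[ℚ] S.D)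
    (ψK : K →ₐ[ℚ] S.D) (I : Submodule ℤ S.D) (hx : Brandt.IsGrossPoint S.O ψ I), Brandt.IsGrossPoint S.O ψK I →
    φ ≠ 0 → Brandt.eigenLattice N (Brandt.matrix S.O) (fun p => W.frobeniusTrace p) = ℤ ∙ φ →
  ∀ (c : k ≃ₐ[ℚ] k) (cK : K ≃ₐ[ℚ] K) (θ : k), c ≠ AlgEquiv.refl → cK ≠ AlgEquiv.refl → θ * θ = -(N : k) →
    (∀ w : K, ψ θ * ψK w = ψK (cK w) * ψ θ) →
    (∀ 𝔞 : ClassGroup (𝓞 k), Even ((Brandt.weight S.O (hx.act 𝔞) : ℤ) * φ (hx.act 𝔞))) ∨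
    (∃ (H : Subgroup (ClassGroup (𝓞 k))) (𝔡 : (Ideal (𝓞 k))⁰), H.index = 3 ∧
        (∀ (ℓ : ℕ) (𝔮 : (Ideal (𝓞 k))⁰), ℓ.Prime → ℓ ≠ 2 → ℓ ≠ N →
            Ideal.absNorm (𝔮 : Ideal (𝓞 k)) = ℓ → (ClassGroup.mk0 𝔮 ∈ H ↔ Even (W.frobeniusTrace ℓ))) ∧
        Ideal.absNorm (𝔡 : Ideal (𝓞 k)) = d.natAbs ∧
        (Even ((Brandt.weight S.O (hx.act 1) : ℤ) * φ (hx.act 1)) ↔ ClassGroup.mk0 𝔡 ∈ H))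

/-- **(β) VANISHING FOR POSITIVE DISCRIMINANT (theorem-candidate ⟸ (TR) + Chebotarev, same mechanism as (D0-ss); NEW in -an g27
§30.4; explains the `κ ≥ 1` of AN-43 at `Δ > 0`).**  For a PRIME `N`, `W` of conductor `N` with `ρ̄_{W,2}` onto `S₃` and `Δ_W > 0`:
then `ℚ(√Δ_W) = ℚ(√N)` is REAL, `ℚ(W[2]) ∌ k = ℚ(√-N)`, `Gal(k(W[2])/k) ≅ S₃` has abelianisation `Gal(k(√-1)/k)`, so the parity of
`a_ℓ(W)` at primes `ℓ` split in `k` is NOT a function of the class of `𝔮_ℓ` in any ring class group of `k`; choosing `𝔮_ℓ ∼ 𝔮_{ℓ'}`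
with `a_ℓ` even and `a_{ℓ'}` odd (Chebotarev in the compositum), (TR) gives `Φ̄(x) = Φ̄(𝔮x) + Φ̄(𝔮̄x) = 0` at EVERY Gross point of
`𝓞_k` (and of `ℤ[√-N]`): **`w·φ` is identically even on the k-torsors.**  Consequently (with (F)) every toric period `m_d(W)` is
EVEN — `ToricPeriodEvenOfPosDisc` — although `L(W,1)/Ω` may be odd (37b1: rank 0, `v₂(L/Ω) = 0`, yet the `ℤ[√-37]`-torsor verdict
is ZERO and 0/176 odd periods in T43): the 2-adic Gross–Waldspurger constant has `κ ≥ 1` exactly here.  T47 j335967: ALL 22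
prime-conductor `S₃` classes with `Δ > 0`, `N ≤ 1000` (28 torsors) are ZERO — including the five of analytic rank 0 with `L(W,1)/Ω`
ODD (37b1, 443c1, 557b1, 701a1, 733a1), so this vanishing is NOT `L`-value parity — and `M_w ≡ 0` on 621/621 `(W, d)` rows; out of sample (j336023, rank 0,
`1000 < N ≤ 2200`): 1613b1, 2089c1, 2089d1, 2143a1 (2089c1 and 2143a1 with `L(W,1)/Ω` odd) — 5/5 torsors ZERO, `M_w` even 173/173.
Cheapest falsifier: one such class with a COSET verdict or one odd `m_d`.
(RIDER, typer -ty g20: `@[conjecture]` per REF1 R261e.  REF1-AUDIT §261: **SURVIVES** — `Δ > 0` rows: 621, `M_w` even 621/621 FULL, OOS 173/173 (T47 shas 8a45d5b08bdeec84 /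
9b6657fd610a6a23); mechanism (TR) + Chebotarev checked on paper (prime conductor + `S₃` ⟹ `Δ_min = ±N^a`, `a` odd, so `Δ > 0` ⟹ `ℚ(√Δ) = ℚ(√N)` real, `k ⊄ ℚ(W[2])`,
`Gal(k(W[2])/k) ≅ S₃` ⟹ «`a_ℓ` odd» is not a ring-class function of `𝔮_ℓ` ⟹ two split primes in one class with opposite parities ⟹ `Φ̄ ≡ 0` by (TR)); as typed a clean
∀-statement, falsifiable by one COSET torsor with `Δ > 0`.  REF2 (22:15Z): **NEW small theorem-candidate, BSD-free, BEYOND PRINT** (three-line mechanism: (TR) + «`a_ℓ mod 2` is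
not a class function of `k` when `k ⊄ ℚ(W[2])`» — for prime `N` and `Δ > 0`, `W` is `ℚ(√N)`-dihedral, [cite: KedlayaMedvedovsky2019, Thm. 2] — + Chebotarev; presearch corpus /
galaxy: none); it is the structural explanation of the `κ ≥ 1` rows that killed AN-43's `κ = 0` ancestor (37b1) — BSD₂-consistent through `c_∞ = 2` (R1).) -/
@[conjecture] def ModTwoToricVanishingOfPosDisc : Prop :=
  ∀ (W : WeierstrassCurve ℚ) [W.IsElliptic] [W.IsGloballyMinimal] (N : ℕ),
    N.Prime → W.conductorNorm ℤ = N → W.HasSurjectiveModNGaloisRep 2 → 0 < W.Δ →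
  ∀ (k : Type) [Field k] [NumberField k], IsImaginaryQuadratic k →
    (NumberField.discr k = -(N : ℤ) ∨ NumberField.discr k = -(4 * N : ℤ)) →
  ∀ (S : Brandt.XiSetup 1 N) [Fintype (Brandt.ClassSet S.O)] (φ : Brandt.ClassSet S.O → ℤ) (ψ : k →ₐ[ℚ] S.D)
    (I : Submodule ℤ S.D) (hx : Brandt.IsGrossPoint S.O ψ I),
    φ ≠ 0 → Brandt.eigenLattice N (Brandt.matrix S.O) (fun p => W.frobeniusTrace p) = ℤ ∙ φ →
    ∀ 𝔞 : ClassGroup (𝓞 k), Even ((Brandt.weight S.O (hx.act 𝔞) : ℤ) * φ (hx.act 𝔞))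

/-- **(β') EVERY TORIC PERIOD IS EVEN WHEN `Δ_W > 0` (theorem-candidate ⟸ (β) on both orders + (F); -an g27 §30.4).**  Census: T43
37b1 0/176 odd (`-d ≤ 1200`, incl. the 18 rows that killed the `κ = 0` form of AN-43); T47 j335967 `POSDELTA`: `M_w` even on 621/621
rows over the 22 classes with `Δ > 0`, `N ≤ 1000`.
BSD₂ reading (R1): for `Δ_W > 0`, `v₂(L^alg(W)·L^alg(W^{(d)})) ≥ 1`... is NOT what it says — the period normalisation changes
(`c_∞(W) = 2`): it says the Gross–Waldspurger identity `L^alg(W)L^alg(W^{(d)}) ≐ 2^{2κ} m_d²/…` holds with `κ ≥ 1`, consistent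
with odd `L^alg(W)L^alg(W^{(d)})` (37b1 has such twists).
(RIDER, typer -ty g20: `@[conjecture]` per REF1 R261e (⟸ (β) on both orders + (F)).  REF1-AUDIT §261: **SURVIVES** — polarity right (evenness; `¬ OddToricPeriod W N K`); `Δ > 0`:
`M_w` even 621/621 + OOS 173/173.  REF2 (22:15Z): as (β) — new small theorem-candidate beyond print; disjoint from AN-43's `Δ < 0` regime (note below).) -/
@[conjecture] def ToricPeriodEvenOfPosDisc : Prop :=
  ∀ (W : WeierstrassCurve ℚ) [W.IsElliptic] [W.IsGloballyMinimal] (N : ℕ),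
    N.Prime → W.conductorNorm ℤ = N → W.HasSurjectiveModNGaloisRep 2 → 0 < W.Δ →
    ∀ (K : Type) [Field K] [NumberField K] (d : ℤ), IsImaginaryQuadratic K →
      NumberField.discr K = d → jacobiSym d N = -1 → ¬ OddToricPeriod W N K

/-! NOTE (-an, folded as text by the typer; in the workfile it heads `theorem posDisc_disjoint_from_AN43_note : True`): Sanity (v9): AN-43 as typed (`DefiniteMod2WaldspurgerLaw`, hypothesis `W.Δ < 0`) and (β') live on DISJOINT regimes; recorded so
that no seat re-files the `Δ > 0` rows as counterexamples to AN-43 (they were, to its κ = 0 ANCESTOR only). -/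

/-- **(E4) NO FIXED POINTS WHEN `4 ∥ d` AND `N ≡ 1 (mod 4)` (theorem-candidate; ONE HILBERT SYMBOL; -an g27 §30.3).**
`N ≡ 1 (mod 4)` prime, `K = ℚ(√d)`, `d = -4m` fundamental with `4 ∥ d` (so `m ≡ 1 (mod 4)`).  A `ρ_d`-fixed Gross point of `𝓞_K`
would give `η, v = ψ_K(√-m) ∈ S.D` with `η² = -N`, `v² = -m`, `ηv = -vη` (see (F)), i.e. `S.D ≅ (-N, -m)_ℚ`; but the Hilbert
symbol `(-N, -m)₂ = (-1)^{ε(-N)ε(-m)} = -1` (both `≡ 3 (mod 4)`) while `S.D` (discriminant `N`, odd) is SPLIT at 2.  Hence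
`Fix ρ_d = ∅` and, by (F), `m_d(W)` is EVEN for every `W` of conductor `N` — the `4 ∥ d` case of the parity law (H) at
`N ≡ 1 (mod 4)` (there `W` is ordinary at 2, and (H) demands `m_d` even for every even `d`).  No hypothesis `(d/N) = -1` and no
curve is involved.  T47 j335967: `|Fix ρ_d| = 0` on ALL 108 `(W, d)` rows with `N ≡ 1 (mod 4)`, `4 ∥ d` (41 with `Δ < 0`, 67 with
`Δ > 0`) and on all 70 such rows of j336023 (`1000 < N ≤ 3000`); `M_w` even on 178/178.
(RIDER, typer -ty g20: PLAIN theorem-target (E4) per REF1 R261e — «ONE HILBERT SYMBOL», elementary, provable now.  REF1-AUDIT §261: **SURVIVES; a PAPER THEOREM**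
(checked: char 0 ⟹ `u, v ≠ 0`, anticommuting ⟹ `{1, u, v, uv}` is a basis and `S.D ≅ (−N, −m)_ℚ`; `−N ≡ −m ≡ 3 (mod 4)` ⟹ `(−N, −m)₂ = −1`, i.e. ramified at 2, contradicting
`ramifiedPlaces = {N}`, `N` odd; `m % 4 = 1` and `N % 4 = 1` both load-bearing — mutations false); R261a (informational): on every one of the 108 `N ≡ 1 (4)`, `4 ∥ d` census
rows an odd `p ∣ d` is inert in `k` — FORCED by reciprocity — so the census cannot distinguish (E4) from the odd-prime obstruction; (E4) stands on its Hilbert-symbol proof, not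
on those rows (the docstring's «no hypothesis `(d/N) = −1` … is involved» is right).  REF2 (22:15Z): elementary, provable now; print: [cite: Serre1973, Ch. III Thm. 1] (Hilbert
symbol at 2).) -/
def NoAnticommutingPairFourExactlyDvd : Prop :=
  ∀ (N m : ℕ), N.Prime → N % 4 = 1 → m % 4 = 1 →
  ∀ (S : Brandt.XiSetup 1 N) (u v : S.D), u * u = -(N : S.D) → v * v = -(m : S.D) → u * v = -(v * u) → False

/-- **(P₈) POSITION LAW FOR `8 ∣ d`, `N ≡ 1 (mod 4)` (theorem-candidate, pure quaternion arithmetic; -an g27 §30.3).**  Setting of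
(P) but `d = -8m`: the transporter of `x(y)` is **`δ = [𝔮₂ · ∏_{p ∣ m} 𝔮_p^{(e_p)}]`** with `𝔮₂` the RAMIFIED prime of
`k = ℚ(√-N)` over 2 — a representative of norm `|d|/4` (`[𝔮₂]` has order 2, so `χ_W(𝔮₂) = 0` for every cubic `χ_W`, and the
value law (D0♯) reads `Φ̄(x(y_e)) = [Σ_p e_p·χ_W(𝔮_p) ≢ 0 (mod 3)]` exactly as for odd `d`).  Since for even `d` the fixed points
realise EVERY sign vector `e ∈ {±1}^{ω(m)}` (`|Fix ρ_d| = 2^{ω(m)}`, (F)) and `e`, `-e` give the same value, `Σ_{Fix} Φ̄` is even: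
`m_d(W)` is EVEN whenever `8 ∣ d` — with (E4) the whole even-`d` half of (H) at `N ≡ 1 (mod 4)`; with (V) + Jacobsthal (§29.11)
the odd-`d` half: the parity law (H) at `N ≡ 1 (mod 4)` is REDUCED to (R), (Tτ), (D0), (P), (P₈), (E4), (F) — all BSD-free.
T47 j335967, cells `N1mod4|·|8∣d` (`N ≤ 1000`, both signs of `Δ`): the 2-component of `δ(x(y))` is `[𝔮₂]` at all 123 of the 131 fixed
points where the decomposition is determinate and undetermined at the other 8 (`h = 4, 6`: a class relation lets both values fit;
engine v2 = kit j336039, out sha16 9b6657fd610a6a23, fields nmatch/nc2) — never determinate-trivial; out of sample (j336023) `[𝔮₂]`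
at 82/82; odd part `∏P_p^{e_p}` and every step law as in (P) (0 failures); `M_w` even on all 151 `(W, d)` rows with `8 ∣ d`
(72 with fixed points, 79 with an odd `p ∣ d` inert in `k` and none) and on all 77 such rows of j336023.
(RIDER, typer -ty g20: `@[conjecture]` per REF1 R261e.  REF1-AUDIT §261: **SURVIVES** — `N ≡ 1 (4)`, `8 ∣ d`: 151 rows (57/94), 72 with fixed points / 79 without (each
of the 79 has an inert odd `p ∣ m`), 131 fixed points (59 + 72), `grp = True` 131/131, `M_w` even 151/151; 2-component: **R261b — engine v1 (kit j335967, 8a45d5b08bdeec84) reads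
129/2, RESOLVED by engine v2 (kit j336039, 9d5c2d3b6ff6213e) into 123 determinate non-trivial `[𝔮₂]` + 8 undetermined (both values fit), determinate-trivial 0**; OOS
(9b6657fd610a6a23) `c2id = False` 82/82, 77 rows `M_w` even.  REF2 (22:15Z): as (P) — small BEYOND-PRINT theorem-candidate (local idelic quaternion arithmetic; ancestry
[cite: GrossZagier1985SingularModuli, §3] linking ideals, with the ramified `𝔮₂`).) -/
@[conjecture] def FixedPointTransporterEightDvd : Prop :=
  ∀ (N : ℕ), N.Prime → N % 4 = 1 →
  ∀ (k : Type) [Field k] [NumberField k], IsImaginaryQuadratic k → NumberField.discr k = -(4 * N : ℤ) →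
  ∀ (K : Type) [Field K] [NumberField K] (d : ℤ), IsImaginaryQuadratic K → NumberField.discr K = d → (8 : ℤ) ∣ d →
    jacobiSym d N = -1 →
  ∀ (S : Brandt.XiSetup 1 N) (ψ : k →ₐ[ℚ] S.D) (ψK : K →ₐ[ℚ] S.D) (I : Submodule ℤ S.D),
    Brandt.IsGrossPoint S.O ψ I → Brandt.IsGrossPoint S.O ψK I →
  ∀ (c : k ≃ₐ[ℚ] k) (cK : K ≃ₐ[ℚ] K) (θ : k), c ≠ AlgEquiv.refl → cK ≠ AlgEquiv.refl → θ * θ = -(N : k) →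
    (∀ w : K, ψ θ * ψK w = ψK (cK w) * ψ θ) →
    ∃ (𝔡 : (Ideal (𝓞 k))⁰) (α : (S.D)ˣ),
      α • Brandt.grossTranslate ψ 𝔡 I = I ∧ (∀ z : k, (α : S.D) * ψ z = ψ (c z) * α) ∧
      4 * Ideal.absNorm (𝔡 : Ideal (𝓞 k)) = d.natAbs

end V9

end Summit.BirchSwinnertonDyer.Rank1Residual.F1Sign2.ANg25
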